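import Summits.BirchSwinnertonDyer.Rank1Residual.SmallImageMu.MuDefectLeFineMu
import Summits.BirchSwinnertonDyer.Rank1Residual.SmallImageMu.MuLeFineMu
import Summits.BirchSwinnertonDyer.Rank1Residual.SmallImageMu.EulerPrimitiveEdges
import Literature.NumberTheory.EllipticCurves.Rank1Residual.RankOneAnchorData
import Summits.BirchSwinnertonDyer.Rank1Residual.SmallImageMu.ConjARoadEdges
import Summits.BirchSwinnertonDyer.Rank1Residual.SmallImageMu.OneSidedTwistSqueezeX9FMWRung
import HarnessLib
set_option autoImplicit false

-- the summit and its single problem are both named `BirchSwinnertonDyer` (registry layout D-0017)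
set_option linter.dupNamespace false

/-!
# Kato's integral divisibility on X9 from statement (A), modulo F1 alone — the hSW-FREE and BCS-FREE closures
# (part 2 of `SmallImageMu/MuDefectLeFineMu.lean`; theorems only)

Cell `bsd-f3-mu`, ES lens (planner-bsd-f3-mu-es g7, MEMO-es §28; sketch HOME/es/MuDefectLeFineMuExact.lean
773863b22deab7c2, landing twin HOME/es/MuDefectLeFineMu.landing.lean 9f00d421f3c999e6 §4–§5b; the ≤ 400-line rule
splits the landing in two).  Part 1 proved S-W⁺ `Rank1Residual.MuDefectLeFineMuAt W p` at every `p ≠ 2` good ordinary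
pair with `E[p]` irreducible modulo F1 = `Kato2004.exists_divisibilityInputs_fineQuotient` alone
(`muDefectLeFineMuAt_of_fineQuotient`, STUB 3 of `Cruxes/KatoDivisibilityX9/Lines/birth.lean` with its print
binder), and per package `mem_charIdeal_of_fineMu_le_eulerLoss`.  THIS PART composes them with the landed edges:
§4 the landed closures of crux 20547 with `hSW` DISCHARGED (`katoDivisibilityOnClassX9_of_conjAOnClassX9_print` =
STUB 2 modulo BCS (a) + modularity + F1; the FMW rung / the per-pair (A)-closure / the cover reduction without `hSW`);
§5b the BCS-FREE roads modulo F1 ALONE: `katoDivisibilityAt_of_fineMuZeroAt_F1`, `katoDivisibilityAt_of_conjAAt_F1`,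
STUB 2 `katoDivisibilityOnClassX9_of_conjAOnClassX9_F1 : F1 → (ConjAOnClassX9 → KatoDivisibilityOnClassX9)` (the crux
`Theses.OneSidedTwistSqueezeX9.KatoDivisibilityX9` by `rfl`; the `--supports` wrapper is a prover's one-liner), the
FMW rung `katoDivisibilityAt_of_rankOneAnchorData(_Tam)_F1`, the Euler-system road and the cover reduction mod F1.
Tree imports only; no new named facts; nothing asserted; 0 sorry.  READING (MEMO-es §28): the birth skeleton of
20547 becomes «STUB 1 (statement (A) on X9, the open node) + ONE published named fact F1».
-/

noncomputable section

open scoped Classical MatrixGroups ModularForm NumberField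
open CongruenceSubgroup WeierstrassCurve Field
open Literature.NumberTheory.GaloisRepresentations
open Literature.NumberTheory.EllipticCurves Literature.NumberTheory.EllipticCurves.ModularForms
open Literature.NumberTheory.EllipticCurves.Kato2004
open Literature.NumberTheory.EllipticCurves.Kato2004.EulerSystemValues
open Literature.NumberTheory.EllipticCurves.IwasawaDual
open Literature.NumberTheory.EllipticCurves.Rank1Residual (MuAnZeroAt MuAlgZeroAt FineMuZeroAt
  MuDefectLeFineMuAt MuDefectNonposAt KatoDivisibilityAt MuLeFineMuAt ConjAAt RankOneAnchorDataAt
  RankOneAnchorDataTamAt)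
open Summit.BirchSwinnertonDyer.BirchSwinnertonDyer.Rank1Residual (ClassX9)
open Module IwasawaAlgebra

namespace Summit.BirchSwinnertonDyer.Rank1Residual.SmallImageMu

section PerPair

variable {p : ℕ} [Fact p.Prime] {W : WeierstrassCurve ℚ} [W.IsElliptic] [W.IsGloballyMinimal]

/-- **The Euler-system road (b4′) WITHOUT `hS`**: ES-C2 `EulerPrimitiveOnClassX9` ∧ F1_ζ ∧ BCS (a) ∧ modularity ⟹
the node — the `hS` binder (shape S2) of `katoDivisibilityOnClassX9_of_eulerPrimitiveOnClassX9` is §3's theorem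
under `fineQuotient_of_zeta`. [cite: Kato2004Asterisque, Thm. 12.6 (p. 222), Thm. 17.4 (p. 273), §17.13 (pp. 279–280)]
[cite: BurungaleCastellaSkinner2025, Thm. 1.1.2 (a) (p. 2 of arXiv:2405.00270v2)] -/
theorem katoDivisibilityOnClassX9_of_eulerPrimitiveOnClassX9_noSW
    (hmodP : nonempty_modularParametrizationData)
    (hfine : exists_divisibilityInputs_fineQuotient_zeta)
    (hBCS : burungale_castella_skinner_charIdeal_eq_padicLFunction)
    (h : EulerPrimitiveOnClassX9) : KatoDivisibilityOnClassX9 :=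
  katoDivisibilityOnClassX9_of_eulerPrimitiveOnClassX9 hmodP hfine hBCS
    (muDefectLeFineMu_shapeS2_of_fineQuotient (fineQuotient_of_zeta hfine)) h

/-! ## §4 NEW — the landed closures of 20547 with `hSW` DISCHARGED (compositions, kernel-checked) -/

/-- **STUB 2 modulo print ONLY** (`wuthrichUpgrade_of_muDefectLeFineMuOnClassX9` of the birth skeleton with its
`hSW` binder fed by §3): BCS (a) → BCDT modularity → F1 → (Conjecture A on X9 → the crux node).
[cite: Wuthrich2006, Thm. 2 and Lemma 3 (p. 717)] [cite: Kato2004Asterisque, §17.13 (pp. 279–280)]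
[cite: BurungaleCastellaSkinner2025, Thm. 1.1.2 (a) (p. 2 of arXiv:2405.00270v2)] -/
theorem katoDivisibilityOnClassX9_of_conjAOnClassX9_print
    (hBCS : burungale_castella_skinner_charIdeal_eq_padicLFunction)
    (hmodP : nonempty_modularParametrizationData) (hfine : exists_divisibilityInputs_fineQuotient)
    (hA : ConjAOnClassX9) : KatoDivisibilityOnClassX9 :=
  katoDivisibilityOnClassX9_of_conjAOnClassX9' hBCS hmodP hfine
    (muDefectLeFineMuOnClassX9_of_fineQuotient hfine) hA

/- Route vocabulary: `Theses.OneSidedTwistSqueezeX9.KatoDivisibilityX9` (item 20547) is the node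
`KatoDivisibilityOnClassX9` by `rfl`, so STUB 2 `ConjAOnClassX9 → KatoDivisibilityX9` is the one-line wrapper
`fun hA ↦ katoDivisibilityOnClassX9_of_conjAOnClassX9_print hBCS hmodP hfine hA` in a prover's `--supports`
file (this cell file stays out of the Theses cone). -/

/-- **The FMW rung WITHOUT `hSW`** (BC5 witness of 20547, 217/415 rank-1 X9 census rows in the FMW spelling):
anchor data + BCS (a) + modularity + F1 ⟹ `KatoDivisibilityAt W p`. [cite: GreenbergLNM1716, Prop. 3.8 (pp. 95–96)]
[cite: Kato2004Asterisque, Thm. 17.4 (p. 273) and §17.13 (pp. 279–280)] -/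
theorem katoDivisibilityAt_of_rankOneAnchorData_noSW
    (hBCS : burungale_castella_skinner_charIdeal_eq_padicLFunction)
    (hmodP : nonempty_modularParametrizationData) (hfine : exists_divisibilityInputs_fineQuotient)
    (hX9 : ClassX9 W p) (hdata : RankOneAnchorDataAt W p) : KatoDivisibilityAt W p :=
  katoDivisibilityAt_of_rankOneAnchorData hBCS hmodP hfine hX9
    (muDefectLeFineMuOnClassX9_of_fineQuotient hfine W p hX9) hdata

/-- **The FMW rung in the Tamagawa spelling WITHOUT `hSW`** (234/415 rows). [cite: GreenbergLNM1716, Prop. 3.8] -/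
theorem katoDivisibilityAt_of_rankOneAnchorDataTam_noSW
    (hBCS : burungale_castella_skinner_charIdeal_eq_padicLFunction)
    (hmodP : nonempty_modularParametrizationData) (hfine : exists_divisibilityInputs_fineQuotient)
    (hX9 : ClassX9 W p) (hdata : RankOneAnchorDataTamAt W p) : KatoDivisibilityAt W p :=
  katoDivisibilityAt_of_rankOneAnchorDataTam hBCS hmodP hfine hX9
    (muDefectLeFineMuOnClassX9_of_fineQuotient hfine W p hX9) hdata

/-- **Per pair: Conjecture A at an X9-type pair ⟹ Kato's integral divisibility, WITHOUT `hSW`.**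
[cite: Kato2004Asterisque, Thm. 17.4 (p. 273) and §17.13 (pp. 279–280)] -/
theorem katoDivisibilityAt_of_conjAAt_noSW
    (hBCS : burungale_castella_skinner_charIdeal_eq_padicLFunction)
    (hmodP : nonempty_modularParametrizationData) (hfine : exists_divisibilityInputs_fineQuotient)
    (hp : 5 ≤ p) (hgood : W.HasGoodReductionAtPrime p) (hord : ¬ (p : ℤ) ∣ W.frobeniusTrace p)
    (hirr : W.HasIrreducibleModPGaloisRep p) (hA : ConjAAt W p) : KatoDivisibilityAt W p :=
  hA.katoDivisibilityAt hBCS hmodP hfine hp hgood hord hirr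
    (muDefectLeFineMuAt_of_fineQuotient hfine (by omega) ⟨hgood, hord⟩ hirr)

/-- **The cover reduction WITHOUT `hSW`**: if every X9 pair carries anchor data (either spelling) or the
divisibility outright, the node holds — modulo BCS (a), modularity, F1.
[cite: Kato2004Asterisque, Thm. 17.4 (p. 273) and §17.13 (pp. 279–280)] -/
theorem katoDivisibilityOnClassX9_of_cover_noSW
    (hBCS : burungale_castella_skinner_charIdeal_eq_padicLFunction)
    (hmodP : nonempty_modularParametrizationData) (hfine : exists_divisibilityInputs_fineQuotient)
    (hcover : ∀ (W : WeierstrassCurve ℚ) [W.IsElliptic] [W.IsGloballyMinimal] (p : ℕ) [Fact p.Prime],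
      ClassX9 W p → RankOneAnchorDataAt W p ∨ RankOneAnchorDataTamAt W p ∨ KatoDivisibilityAt W p) :
    KatoDivisibilityOnClassX9 :=
  katoDivisibilityOnClassX9_of_rankOneAnchorData_of_cover hBCS hmodP hfine
    (muDefectLeFineMuOnClassX9_of_fineQuotient hfine) hcover

/-! ## §5b NEW — BCS-FREE ROADS: fine `μ = 0` / Conjecture A / anchor data ⟹ Kato's INTEGRAL divisibility,
modulo F1 ALONE (no BCS 2025 Thm. 1.1.2 (a), no modular-parametrisation supply, no S-W⁺) -/

/-- **Fine `μ = 0` at the pair ⟹ `KatoDivisibilityAt W p`, modulo F1 alone** (`p ≠ 2` good ordinary, `E[p]`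
irreducible — X9 AND X10b pairs alike).  For the data `(κ, γ, f, D)`: F1 gives a package `K` with an exact fine
quotient `X ↠ Y.X` onto the tree's fine datum `W.fineSelmerDualData κ hγ`; `Y.X` is f.g. torsion FROM THE PACKAGE
(`Kim2025.moduleFinite_fine_of_package` / `isTorsion_fine_of_package`), so `FineMuZeroAt` gives `μ(Y.X) = 0`,
i.e. `ℓ_(p)(Y.X) = 0`; §5a then puts `G₁` (`ι G₁ = L_p`, GV Prop. 3.7 `exists_iwasawaToPowerSeries_eq_padicLFunction`)
in `char X`. [cite: Kato2004Asterisque, Thm. 17.4 (p. 273), §17.13 (pp. 279–280)] [cite: GreenbergVatsal2000, Prop. 3.7]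
[cite: Washington1997, §13.2] -/
theorem katoDivisibilityAt_of_fineMuZeroAt_F1 (hfine : exists_divisibilityInputs_fineQuotient)
    (hp2 : p ≠ 2) (hord : IsOrdinaryAt W p) (hirr : W.HasIrreducibleModPGaloisRep p)
    (h0 : FineMuZeroAt W p) : KatoDivisibilityAt W p := by
  intro κ γ N _ f hκ hγ hγ' hf D
  haveI : ContinuousSMul ℤ_[p] (W.tateModule p) := TateModule.continuousSMul_padicInt
  haveI : Module.Finite (IwasawaAlgebra p) D.X :=
    WeierstrassCurve.SelmerDualData.module_finite_of_isCyclotomic W κ hκ D hγ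
  obtain ⟨I⟩ := Kato2004.nonempty_iwasawaH1Data_holds W p κ γ hκ hγ
  let Y : W.FineSelmerDualData κ γ := W.fineSelmerDualData κ hγ
  obtain ⟨K, π, hπs, hπ⟩ := hfine W p f κ γ hp2 hord hκ hγ hγ' hf I D Y
  obtain ⟨G₁, hG₁⟩ := exists_iwasawaToPowerSeries_eq_padicLFunction hp2 hord hf hirr
  haveI : Module.Finite (IwasawaAlgebra p) Y.X := Kim2025.moduleFinite_fine_of_package K π hπs hπ
  have hYt : Module.IsTorsion (IwasawaAlgebra p) Y.X := Kim2025.isTorsion_fine_of_package K π hπs hπ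
  have hμY : muInvariant p Y.X = 0 := h0 κ γ hκ hγ hγ' Y inferInstance hYt
  exact ⟨G₁, mem_charIdeal_of_fineMu_le_eulerLoss K hirr hord hf hG₁ π hπs hπ hYt (by rw [hμY]; exact Nat.zero_le _),
    hG₁⟩

/-- **Conjecture A at the pair ⟹ Kato's integral divisibility at the pair, modulo F1 ALONE** (T0
`ConjAAt.fineMuZeroAt` is a tree theorem).  Compare the landed `ConjAAt.katoDivisibilityAt`, which needs
BCS (a), modularity, F1 AND S-W⁺. [cite: Kato2004Asterisque, Thm. 17.4 (p. 273), §17.13 (pp. 279–280)]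
[cite: Washington1997, §13.2] -/
theorem katoDivisibilityAt_of_conjAAt_F1 (hfine : exists_divisibilityInputs_fineQuotient)
    (hp2 : p ≠ 2) (hord : IsOrdinaryAt W p) (hirr : W.HasIrreducibleModPGaloisRep p)
    (hA : ConjAAt W p) : KatoDivisibilityAt W p :=
  katoDivisibilityAt_of_fineMuZeroAt_F1 hfine hp2 hord hirr hA.fineMuZeroAt

/-- **STUB 2 of `Lines/birth.lean` modulo F1 ALONE, as a closure of the cell node `KatoDivisibilityOnClassX9`
(= the crux `Theses.OneSidedTwistSqueezeX9.KatoDivisibilityX9` by `rfl`): `ConjAOnClassX9 → KatoDivisibilityOnClassX9`**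
— Wuthrich's upgrade on X9 needs neither BCS 2025 nor a modular-parametrisation supply nor S-W⁺: only Kato's §17.13
package (F1).  After this the registered skeleton of crux 20547 reads «STUB 1 (statement (A) on X9) + F1»; the
route-vocabulary wrapper is `fun hA ↦ katoDivisibilityOnClassX9_of_conjAOnClassX9_F1 hfine hA` in a prover's
`--supports` file. [cite: Kato2004Asterisque, Thm. 17.4 (p. 273), §17.13 (pp. 279–280)]
[cite: Wuthrich2006, Thm. 2 / Lemma 3 (the upgrade, printed for rank 0)] -/
theorem katoDivisibilityOnClassX9_of_conjAOnClassX9_F1 (hfine : exists_divisibilityInputs_fineQuotient)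
    (hA : ConjAOnClassX9) : KatoDivisibilityOnClassX9 := by
  intro W _ _ p _ κ γ N _ f hX9 hκ hγ hγ' hf D
  obtain ⟨-, hp, hgood, hord, hirr, -⟩ := id hX9
  exact katoDivisibilityAt_of_conjAAt_F1 hfine (by omega) ⟨hgood, hord⟩ hirr (hA W p hX9) κ γ f hκ hγ hγ' hf D

/-- **The FMW rung of 20547 modulo F1 ALONE** (BC5 witness; 217/415 rank-1 X9 census rows in the FMW spelling):
anchor data ⟹ (A) (`conjAAt_of_rankOneAnchorData`, landed, unconditional) ⟹ divisibility (§5b).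
[cite: GreenbergLNM1716, Prop. 3.8 (pp. 95–96)] [cite: Kato2004Asterisque, Thm. 17.4 (p. 273), §17.13 (pp. 279–280)] -/
theorem katoDivisibilityAt_of_rankOneAnchorData_F1 (hfine : exists_divisibilityInputs_fineQuotient)
    (hX9 : ClassX9 W p) (hdata : RankOneAnchorDataAt W p) : KatoDivisibilityAt W p := by
  obtain ⟨-, hp, hgood, hord, hirr, -⟩ := id hX9
  exact katoDivisibilityAt_of_conjAAt_F1 hfine (by omega) ⟨hgood, hord⟩ hirr (conjAAt_of_rankOneAnchorData hdata)

/-- **The FMW rung in the Tamagawa spelling modulo F1 ALONE** (234/415 rows). [cite: GreenbergLNM1716, Prop. 3.8] -/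
theorem katoDivisibilityAt_of_rankOneAnchorDataTam_F1 (hfine : exists_divisibilityInputs_fineQuotient)
    (hX9 : ClassX9 W p) (hdata : RankOneAnchorDataTamAt W p) : KatoDivisibilityAt W p := by
  obtain ⟨-, hp, hgood, hord, hirr, -⟩ := id hX9
  exact katoDivisibilityAt_of_conjAAt_F1 hfine (by omega) ⟨hgood, hord⟩ hirr (conjAAt_of_rankOneAnchorDataTam hdata)

/-- **ES-C2 (Euler-primitivity on X9) ⟹ the node, modulo F1 ALONE** (via `conjAOnClassX9_of_eulerPrimitiveOnClassX9`,
unconditional). [cite: Kato2004Asterisque, Thm. 17.4 (p. 273), §17.13 (pp. 279–280)] -/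
theorem katoDivisibilityOnClassX9_of_eulerPrimitiveOnClassX9_F1 (hfine : exists_divisibilityInputs_fineQuotient)
    (h : EulerPrimitiveOnClassX9) : KatoDivisibilityOnClassX9 :=
  katoDivisibilityOnClassX9_of_conjAOnClassX9_F1 hfine (conjAOnClassX9_of_eulerPrimitiveOnClassX9 h)

/-- **The cover reduction modulo F1 ALONE.** [cite: Kato2004Asterisque, Thm. 17.4 (p. 273), §17.13 (pp. 279–280)] -/
theorem katoDivisibilityOnClassX9_of_cover_F1 (hfine : exists_divisibilityInputs_fineQuotient)
    (hcover : ∀ (W : WeierstrassCurve ℚ) [W.IsElliptic] [W.IsGloballyMinimal] (p : ℕ) [Fact p.Prime],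
      ClassX9 W p → RankOneAnchorDataAt W p ∨ RankOneAnchorDataTamAt W p ∨ KatoDivisibilityAt W p) :
    KatoDivisibilityOnClassX9 := by
  intro W _ _ p _ κ γ N _ f hX9 hκ hγ hγ' hf D
  rcases hcover W p hX9 with h | h | h
  · exact katoDivisibilityAt_of_rankOneAnchorData_F1 hfine hX9 h κ γ f hκ hγ hγ' hf D
  · exact katoDivisibilityAt_of_rankOneAnchorDataTam_F1 hfine hX9 h κ γ f hκ hγ hγ' hf D
  · exact h κ γ f hκ hγ hγ' hf D

end PerPair

end Summit.BirchSwinnertonDyer.Rank1Residual.SmallImageMu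

end
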